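import Literature.AlgebraicGeometry.AbelianSchemes.IsLambdaOfAtAlongIsogeny
import Literature.AlgebraicGeometry.AbelianSchemes.AbelianSchemeQuotientMulNDescent
import Literature.AlgebraicGeometry.HodgeTheory.AbelianVarietyIsogenyDegreeHomology
import HarnessLib

/-!
# Kernel counts for a retraction `a ≫ b = [n]` read on geometric fibre points

Topic `AlgebraicGeometry/AbelianSchemes`; namespace `Literature.AlgebraicGeometry.AbelianSchemes.AbelianSchemeOver`.
THEOREMS ONLY (no definition, no named fact, no instance, no notation, no `sorry`; net Literature debt 0).  Cell
hodgecm-mathlib (D-0151), HECKE-LINK line, socket (B), `hExt.htype` / the `hcount` binder of ★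
`HeckeQuotientTripleHasType.Polarization.hasType_polarizationDesc_of_count` (B-plan1 (g15) 00:34:18Z (2)).  Two small
bricks for the dual-side kernel count `|ker ψ^∨_s| · |K′| = |Â_s[n]|` (from `ψ̂ ≫ ψ^∨ = [n]_Â`, B-p05 (g16)):
* `algPointsMap_algPointsMap_eq_pow_of_comp_eq_mulN` — for homomorphisms `a : P → Q`, `b : Q → P` of abelian schemes with
  `a ≫ b = [n]_P`, on `Ω`-points of the fibres `b_s (a_s z) = z ^ n` (★ `fibrePointToLeft_map_fibreHom`, ★
  `fibrePointToLeft_pow`);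
* `finite_ker_and_natCard_mul_eq_of_apply_apply_eq_pow` (+ `…mul_natCard_eq…` with `|ker f| = c` substituted) — PURE GROUP
  THEORY over abstract commutative groups: `f` onto, `g (f z) = z ^ n`, `|X[n]| ≠ 0` ⟹ `ker g` finite and
  `|ker f| · |ker g| = |X[n]|` (★ `IsogenyDegree.natCard_ker_comp_of_surjective`).  DESIGN NOTE for the composer: keep the
  counting algebra in these abstract lemmas and instantiate at `(A.fibre s).toAbelianVariety.Points Ω` by ONE `exact`
  (`f := ψ̂_s`, `g := ψ^∨_s` as `IsMonHom.monoidHom (fibreHom _ s).hom.hom.hom (specOver Ω Ω)`, `|ker ψ̂_s| = |K′|` by ★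
  `natCard_ker_fibreHom_quotientMk`): rewriting between the `MonoidHom.comp`-world and the `powMonoidHom`-world at the
  concrete points groups costs instance unfoldings close to the heartbeat limit.
HC_CM is proved only modulo the 7 printed citations until rung 0 closes; this file discharges none of them.

## References
* [MumfordAV1970] D. Mumford, *Abelian Varieties* (1970), §7 Thm. 4 (p. 72), §15 Thm. 1 (p. 143).
-/

set_option autoImplicit false

noncomputable section

universe u

open CategoryTheory CategoryTheory.Limits AlgebraicGeometry

open scoped MonObj

namespace Literature.AlgebraicGeometry.AbelianSchemes

namespace AbelianSchemeOver

open Literature.AlgebraicGeometry.Motives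

variable {S : Scheme.{u}} {P Q : AbelianSchemeOver S}

/-- **`a ≫ b = [n]` on `Ω`-points: `b_s (a_s z) = z ^ n`** for homomorphisms `a : P → Q`, `b : Q → P` of abelian schemes with
`a ≫ b = [n]_P` (the two fibre homomorphisms composed on an `Ω`-point lie over `z ≫ a ≫ b = z ≫ [n]`, and the `n`-th power of a
fibre point lies over `· ≫ [n]`; used at `a := ψ̂`, `b := ψ^∨`). [cite: MumfordAV1970, §15 Thm. 1 (p. 143) and §7 Thm. 4 (p. 72)] -/
theorem algPointsMap_algPointsMap_eq_pow_of_comp_eq_mulN (a : P.X ⟶ Q.X) (b : Q.X ⟶ P.X) [IsMonHom a] [IsMonHom b]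
    (n : ℕ) (h : a ≫ b = P.mulN n) {Ω : Type u} [Field Ω] (s : Spec (.of Ω) ⟶ S)
    (z : (P.fibre s).toAbelianVariety.Points Ω) :
    AlgPoints.map (fibreHom b s).hom.hom.hom (AlgPoints.map (fibreHom a s).hom.hom.hom z) = z ^ n := by
  apply P.fibrePointToLeft_injective s
  rw [fibrePointToLeft_map_fibreHom, fibrePointToLeft_map_fibreHom, fibrePointToLeft_pow, Category.assoc,
    ← Over.comp_left, h, AbelianSchemeOver.mulN]

/-- **Pure group theory: `|ker f| · |ker g| = |ker (·)^n|` and `ker g` finite**, for `f : X → Y` onto, `g : Y → X` with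
`g (f z) = z ^ n`, and `X[n]` of non-zero cardinality (★ `IsogenyDegree.natCard_ker_comp_of_surjective`; stated over
abstract commutative groups so that the instantiation at `Ω`-points is definitionally cheap). [cite: MumfordAV1970, §7 Thm. 4 (p. 72)] -/
theorem finite_ker_and_natCard_mul_eq_of_apply_apply_eq_pow {X Y : Type*} [CommGroup X] [CommGroup Y] (f : X →* Y)
    (g : Y →* X) (n : ℕ) (hcomp : ∀ z, g (f z) = z ^ n) (hf : Function.Surjective f)
    (hne : Nat.card (powMonoidHom n : X →* X).ker ≠ 0) :
    Finite g.ker ∧ Nat.card f.ker * Nat.card g.ker = Nat.card (powMonoidHom n : X →* X).ker := by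
  have hF : g.comp f = powMonoidHom n := MonoidHom.ext fun z => by simp [hcomp]
  have hprod : Nat.card f.ker * Nat.card g.ker = Nat.card (powMonoidHom n : X →* X).ker := by
    rw [← hF]
    exact (Literature.AlgebraicGeometry.HodgeTheory.IsogenyDegree.natCard_ker_comp_of_surjective f g hf).symm
  refine ⟨Nat.finite_of_card_ne_zero fun h0 => hne ?_, hprod⟩
  rw [← hprod, h0, mul_zero]

/-- The same with `|ker f|` replaced by a given number `c` (`hcf : |ker f| = c`), so that a concrete instantiation is ONE
`exact`. [cite: MumfordAV1970, §7 Thm. 4 (p. 72)] -/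
theorem finite_ker_and_mul_natCard_eq_of_apply_apply_eq_pow {X Y : Type*} [CommGroup X] [CommGroup Y] (f : X →* Y)
    (g : Y →* X) (n : ℕ) (hcomp : ∀ z, g (f z) = z ^ n) (hf : Function.Surjective f)
    (hne : Nat.card (powMonoidHom n : X →* X).ker ≠ 0) {c : ℕ} (hcf : Nat.card f.ker = c) :
    Finite g.ker ∧ c * Nat.card g.ker = Nat.card (powMonoidHom n : X →* X).ker := by
  subst hcf
  exact finite_ker_and_natCard_mul_eq_of_apply_apply_eq_pow f g n hcomp hf hne


end AbelianSchemeOver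

end Literature.AlgebraicGeometry.AbelianSchemes

end
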